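import Summits.QuantumAdvantage.QuantumAdvantage.Theorems.CertDialI
import HarnessLib

/-!
# CertDial — part K (§13): THE FIRST WEIGHT-5 LAW — the «pent» input `1_{0,1,M,2M-1,2M}` — and THE BLOCK OF FIVE beats the antipodes

§13a extends the light-input kernel atlas (§8, weight `≤ 3`) by its first weight-5 page: for even `n`, even `M ≥ 2`, `2M + 1 < n`, the
odd-class input `pentIn n M = 1_{0,1,M,2M-1,2M}` (parities `e o e o e`) has the explicit kernel vector `pentVec n M` = (evens outside
`[2, 2M-2]`) ∪ (odds inside `[1, 2M-1]`), sign bit `0`, hence the PENT LAW `rel_pent_iff`: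
`Rel (pentIn n M) z ⟺ #{b : ((b even ∧ (b < 2 ∨ 2M-2 < b)) ∨ (b odd ∧ b < 2M)), z b} is even`.
WHY THIS INPUT: numerically (g28 `num/poolscan.py`, `ninecheck.py`) the NINE LIGHTS — the eight two-one/monochromatic triples of
`{0, 1, M, 2M-1, 2M}` other than `{0,1,M}`, `{M,2M-1,2M}`, together with `pentIn n M` — form a size-9 XOR certificate (M = 2r+2) against every
ANTIPODAL-`r`-LOCAL answer map (free position-dependent tables reading `x` on `[b-r, b+r] ∪ [b+n/2-r, b+n/2+r]`) at every even `n ≥ 12r+10`,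
and against every «slit-local» map with slit separation `≥ 2M+2r+1`: the weight-5 analogue of §9's FIVE LIGHTS.  The eight triples are
already governed by §8 (`rel_mono_iff`, `rel_triAt_iff`); the pent law is the one new ingredient, proved here.
§13b THE BLOCK OF FIVE (`M = 2`: `pentIn n 2 = 1_{[0,4]}`) defeats the XOR-antipode of §10 at every `n ≡ 2 (mod 4)`, `n ≥ 10`
(`xorAnti_loses_block`) and the OR-antipode of §11 at every `4 ∣ n`, `n ≥ 12` (`orAnti_loses_block`): the weight parameter of these
perfect-to-three strategies is exactly `3` (numerics, g28 `num/`: the period-4 affine `p4Anti t` of §12 loses the block too, all `t`, `4 ∣ n`,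
`12 ≤ n ≤ 52`).  Imports part I only (independent of part J).  Nothing here touches the weight-7 leaves or 27432.
`lean check` on the tree closure: rc 0, no warnings, no placeholders; axioms standard (`propext`, `Classical.choice`, `Quot.sound`).
-/

set_option linter.dupNamespace false
set_option linter.style.longLine false

noncomputable section
open scoped Classical

namespace Summit.QuantumAdvantage.QuantumAdvantage.Theorems.CertDial
open Finset
open Literature.Computability.QuantumComplexity Literature.Computability.QuantumComplexity.RingHLF
open Summit.QuantumAdvantage.AdviceFreeQNC0
open Literature.Computability.MetaComplexity Literature.Computability.MetaComplexity.Smolensky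
open Summit.QuantumAdvantage.QuantumAdvantage.Theorems.LightDial (wt ind onesOf ind_onesOf wt_eq_card_onesOf oddZeros_ind_iff
  mono_singleton_apply)
open Summit.QuantumAdvantage.QuantumAdvantage.Theorems.ParityDial (par offs IsParityLocal PGlobalFail)
open Summit.QuantumAdvantage.AdviceFreeQNC0.LightConeWindowHard (window window_apply)
open Summit.QuantumAdvantage.AdviceFreeQNC0.RingSymmetry (shift rot_apply rel_rot card_filter_shift shift_shift)

variable {n : ℕ}

/-! ### §13a The pent law (weight 5, parity pattern `e o e o e` in the shape `{0, 1, M, 2M-1, 2M}`) -/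

/-- the pent input `1_{0, 1, M, 2M-1, 2M}`. -/
def pentIn (n M : ℕ) : Fin n → Bool := fun b => decide ((b : ℕ) = 0 ∨ (b : ℕ) = 1 ∨ (b : ℕ) = M ∨ (b : ℕ) = 2 * M - 1 ∨ (b : ℕ) = 2 * M)

/-- its kernel vector: the even positions outside `[2, 2M-2]` together with the odd positions inside `[1, 2M-1]`. -/
def pentVec (n M : ℕ) : Fin n → Bool := fun b =>
  decide (((b : ℕ) % 2 = 0 ∧ ((b : ℕ) < 2 ∨ 2 * M - 2 < (b : ℕ))) ∨ ((b : ℕ) % 2 = 1 ∧ (b : ℕ) < 2 * M))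

/-- the pent input has weight `5` (`2 ≤ M`, `2M < n`). -/
theorem card_pentIn {M : ℕ} (hM : 2 ≤ M) (hMn : 2 * M < n) : (univ.filter fun b : Fin n => pentIn n M b = true).card = 5 := by
  have hset : (univ.filter fun b : Fin n => pentIn n M b = true) =
      {⟨0, by omega⟩, ⟨1, by omega⟩, ⟨M, by omega⟩, ⟨2 * M - 1, by omega⟩, ⟨2 * M, hMn⟩} := by
    ext b
    simp only [Finset.mem_filter, Finset.mem_univ, true_and, pentIn, decide_eq_true_eq, Finset.mem_insert, Finset.mem_singleton,
      Fin.ext_iff]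
  rw [hset, Finset.card_insert_of_notMem (by simp [Fin.ext_iff]; omega), Finset.card_insert_of_notMem (by simp [Fin.ext_iff]; omega),
    Finset.card_insert_of_notMem (by simp [Fin.ext_iff]; omega), Finset.card_pair (by simp [Fin.ext_iff]; omega)]

/-- so it is in the odd class (even `n`). -/
theorem oddZeros_pentIn (he : n % 2 = 0) {M : ℕ} (hM : 2 ≤ M) (hMn : 2 * M < n) : OddZeros (pentIn n M) := by
  unfold OddZeros
  have hc := Finset.card_filter_add_card_filter_not (s := (univ : Finset (Fin n))) (fun b : Fin n => pentIn n M b = true)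
  rw [card_pentIn hM hMn, Finset.card_univ, Fintype.card_fin] at hc
  rw [Finset.filter_congr fun b _ => show (pentIn n M b = false) ↔ ¬ (pentIn n M b = true) by simp]
  omega

/-- the pent vector lies in the kernel of the pent input (even `n`, even `M ≥ 2`, `2M + 1 < n`). -/
theorem inKernel_pentVec (he : n % 2 = 0) {M : ℕ} (hM2 : M % 2 = 0) (hM : 2 ≤ M) (hMn : 2 * M + 1 < n) :
    InKernel (pentIn n M) (pentVec n M) := by
  intro b
  have hb := b.isLt
  rw [xor_xor_and_eq_false_iff]
  simp only [pentVec, pentIn, decide_eq_true_eq, LightConeWindowHard.prv_val, LightConeWindowHard.nxt_val]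
  split_ifs <;> omega

/-- the pent vector is nonzero. -/
theorem pentVec_ne_zero (hn : 1 ≤ n) (M : ℕ) : pentVec n M ≠ fun _ => false := by
  intro h; have := congrFun h ⟨0, by omega⟩; simp [pentVec] at this

/-- exactly two ring edges lie inside the pent vector: `{0,1}` and `{2M-1, 2M}`. -/
theorem edgesIn_pentVec (he : n % 2 = 0) {M : ℕ} (hM2 : M % 2 = 0) (hM : 2 ≤ M) (hMn : 2 * M + 1 < n) : edgesIn (pentVec n M) = 2 := by
  unfold edgesIn
  rw [Finset.card_eq_two]
  refine ⟨⟨0, by omega⟩, ⟨2 * M - 1, by omega⟩, ?_, ?_⟩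
  · simp [Fin.ext_iff]; omega
  · ext b
    have hb := b.isLt
    simp only [Finset.mem_filter, Finset.mem_univ, true_and, pentVec, decide_eq_true_eq, LightConeWindowHard.nxt_val,
      Finset.mem_insert, Finset.mem_singleton, Fin.ext_iff]
    split_ifs <;> omega

/-- the pent input meets its kernel vector in four ones (`0, 1, 2M-1, 2M`; the middle one `M` is outside). -/
theorem wtAnd_pentVec {M : ℕ} (hM2 : M % 2 = 0) (hM : 2 ≤ M) (hMn : 2 * M + 1 < n) : wtAnd (pentIn n M) (pentVec n M) = 4 := by
  unfold wtAnd
  have hset : (univ.filter fun b : Fin n => pentIn n M b = true ∧ pentVec n M b = true) =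
      {⟨0, by omega⟩, ⟨1, by omega⟩, ⟨2 * M - 1, by omega⟩, ⟨2 * M, by omega⟩} := by
    ext b
    simp only [Finset.mem_filter, Finset.mem_univ, true_and, pentIn, pentVec, decide_eq_true_eq, Finset.mem_insert,
      Finset.mem_singleton, Fin.ext_iff]
    omega
  rw [hset, Finset.card_insert_of_notMem (by simp [Fin.ext_iff]; omega), Finset.card_insert_of_notMem (by simp [Fin.ext_iff]; omega),
    Finset.card_pair (by simp [Fin.ext_iff]; omega)]

/-- so the sign bit of the pent input is `0`. -/
theorem signBit_pentVec (he : n % 2 = 0) {M : ℕ} (hM2 : M % 2 = 0) (hM : 2 ≤ M) (hMn : 2 * M + 1 < n) :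
    signBit (pentIn n M) (pentVec n M) = 0 := by
  unfold signBit
  rw [edgesIn_pentVec he hM2 hM hMn, wtAnd_pentVec hM2 hM hMn]

/-- ★ PENT LAW (the first weight-5 page of the atlas).  Even `n`, even `M ≥ 2`, `2M + 1 < n`, `x = 1_{0,1,M,2M-1,2M}`, ANY answer `z`:
`Rel x z ⟺ the number of `1`-answers at the positions (even, outside [2, 2M-2]) or (odd, inside [1, 2M-1]) is even`. -/
theorem rel_pent_iff (he : n % 2 = 0) {M : ℕ} (hM2 : M % 2 = 0) (hM : 2 ≤ M) (hMn : 2 * M + 1 < n) (z : Fin n → Bool) :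
    Rel (pentIn n M) z ↔ (univ.filter fun b : Fin n =>
      (((b : ℕ) % 2 = 0 ∧ ((b : ℕ) < 2 ∨ 2 * M - 2 < (b : ℕ))) ∨ ((b : ℕ) % 2 = 1 ∧ (b : ℕ) < 2 * M)) ∧ z b = true).card % 2 = 0 := by
  rw [rel_iff_of_explicit (by omega) (oddZeros_pentIn he hM (by omega)) (inKernel_pentVec he hM2 hM hMn) (pentVec_ne_zero (by omega) M) z,
    signBit_pentVec he hM2 hM hMn]
  unfold dot2
  rw [Finset.filter_congr fun (b : Fin n) _ => show (pentVec n M b = true ∧ z b = true) ↔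
      ((((b : ℕ) % 2 = 0 ∧ ((b : ℕ) < 2 ∨ 2 * M - 2 < (b : ℕ))) ∨ ((b : ℕ) % 2 = 1 ∧ (b : ℕ) < 2 * M)) ∧ z b = true) by
    simp [pentVec]]

/-- the pent law in strategy language. -/
theorem win_pent_iff (he : n % 2 = 0) {M : ℕ} (hM2 : M % 2 = 0) (hM : 2 ≤ M) (hMn : 2 * M + 1 < n) (P : Fin n → CubeFn (ZMod 3) n) :
    Rel (pentIn n M) (ans P (pentIn n M)) ↔ (univ.filter fun b : Fin n =>
      (((b : ℕ) % 2 = 0 ∧ ((b : ℕ) < 2 ∨ 2 * M - 2 < (b : ℕ))) ∨ ((b : ℕ) % 2 = 1 ∧ (b : ℕ) < 2 * M)) ∧ P b (pentIn n M) = 1).card % 2 = 0 := by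
  rw [rel_pent_iff he hM2 hM hMn]
  rw [Finset.filter_congr fun (b : Fin n) _ => show ((((b : ℕ) % 2 = 0 ∧ ((b : ℕ) < 2 ∨ 2 * M - 2 < (b : ℕ))) ∨
      ((b : ℕ) % 2 = 1 ∧ (b : ℕ) < 2 * M)) ∧ ans P (pentIn n M) b = true) ↔ ((((b : ℕ) % 2 = 0 ∧ ((b : ℕ) < 2 ∨ 2 * M - 2 < (b : ℕ))) ∨
      ((b : ℕ) % 2 = 1 ∧ (b : ℕ) < 2 * M)) ∧ P b (pentIn n M) = 1) by simp [ans]]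

/-! ### §13b The block of five beats the antipodes -/

/-- the block of five: `pentIn n 2 = 1_{[0,4]}`. -/
theorem pentIn_two_apply (c : Fin n) : pentIn n 2 c = decide ((c : ℕ) ≤ 4) := by
  simp only [pentIn, decide_eq_decide]; omega

/-- counting over the block of five. -/
theorem card_filter_and_block (F : Fin n → Prop) [DecidablePred F] (hn : 5 ≤ n) :
    (univ.filter fun c : Fin n => F c ∧ pentIn n 2 c = true).card = (if F ⟨0, by omega⟩ then 1 else 0) + (if F ⟨1, by omega⟩ then 1 else 0) +
      (if F ⟨2, by omega⟩ then 1 else 0) + (if F ⟨3, by omega⟩ then 1 else 0) + (if F ⟨4, by omega⟩ then 1 else 0) := by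
  have hset : (univ.filter fun c : Fin n => F c ∧ pentIn n 2 c = true) =
      (({(⟨0, by omega⟩ : Fin n), ⟨1, by omega⟩, ⟨2, by omega⟩, ⟨3, by omega⟩, ⟨4, by omega⟩} : Finset (Fin n)).filter F) := by
    ext c
    simp only [mem_filter, mem_univ, true_and, mem_insert, mem_singleton, pentIn_two_apply, decide_eq_true_eq, Fin.ext_iff]
    constructor
    · rintro ⟨hF, hc⟩; exact ⟨by omega, hF⟩
    · rintro ⟨hc, hF⟩; exact ⟨hF, by omega⟩
  rw [hset, Finset.card_filter, sum_insert, sum_insert, sum_insert, sum_insert, sum_singleton]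
  · simp only [add_assoc]
  · simp only [mem_singleton, Fin.ext_iff]; omega
  · simp only [mem_insert, mem_singleton, Fin.ext_iff]; omega
  · simp only [mem_insert, mem_singleton, Fin.ext_iff]; omega
  · simp only [mem_insert, mem_singleton, Fin.ext_iff]; omega

/-- ★ THE BLOCK OF FIVE BEATS THE XOR-ANTIPODE: at every `n ≡ 2 (mod 4)`, `n ≥ 10`, the §10 strategy `xorAnti` (perfect to weight 3)
LOSES on `1_{[0,4]}` — its count over the pent electorate is `3 + 2`. -/
theorem xorAnti_loses_block (h4 : n % 4 = 2) (hn : 10 ≤ n) : ¬ Rel (pentIn n 2) (ans (xorAnti n) (pentIn n 2)) := by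
  have he : n % 2 = 0 := by omega
  rw [rel_pent_iff he (M := 2) rfl le_rfl (by omega), ans_xorAnti, card_xor_mod_two, card_filter_and_shift _ _ (show 1 ≤ n by omega),
    card_filter_and_shift _ _ (show n / 2 ≤ n by omega), card_filter_and_block _ (by omega), card_filter_and_block _ (by omega)]
  simp only [val_shift]
  have e0 : (0 + (n - 1)) % n = n - 1 := by rw [Nat.zero_add]; exact Nat.mod_eq_of_lt (by omega)
  have e1 : (1 + (n - 1)) % n = 0 := by rw [show 1 + (n - 1) = n by omega, Nat.mod_self]
  have e2 : (2 + (n - 1)) % n = 1 := by rw [show 2 + (n - 1) = 1 + n by omega, Nat.add_mod_right, Nat.mod_eq_of_lt (by omega)]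
  have e3 : (3 + (n - 1)) % n = 2 := by rw [show 3 + (n - 1) = 2 + n by omega, Nat.add_mod_right, Nat.mod_eq_of_lt (by omega)]
  have e4 : (4 + (n - 1)) % n = 3 := by rw [show 4 + (n - 1) = 3 + n by omega, Nat.add_mod_right, Nat.mod_eq_of_lt (by omega)]
  have g0 : (0 + (n - n / 2)) % n = n / 2 := by rw [show 0 + (n - n / 2) = n / 2 by omega, Nat.mod_eq_of_lt (by omega)]
  have g1 : (1 + (n - n / 2)) % n = n / 2 + 1 := by rw [show 1 + (n - n / 2) = n / 2 + 1 by omega, Nat.mod_eq_of_lt (by omega)]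
  have g2 : (2 + (n - n / 2)) % n = n / 2 + 2 := by rw [show 2 + (n - n / 2) = n / 2 + 2 by omega, Nat.mod_eq_of_lt (by omega)]
  have g3 : (3 + (n - n / 2)) % n = n / 2 + 3 := by rw [show 3 + (n - n / 2) = n / 2 + 3 by omega, Nat.mod_eq_of_lt (by omega)]
  have g4 : (4 + (n - n / 2)) % n = n / 2 + 4 := by rw [show 4 + (n - n / 2) = n / 2 + 4 by omega, Nat.mod_eq_of_lt (by omega)]
  have f0 : ¬ (((n - 1) % 2 = 0 ∧ (n - 1 < 2 ∨ 2 * 2 - 2 < n - 1)) ∨ ((n - 1) % 2 = 1 ∧ n - 1 < 2 * 2)) := by omega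
  have k0 : ¬ (((n / 2) % 2 = 0 ∧ (n / 2 < 2 ∨ 2 * 2 - 2 < n / 2)) ∨ ((n / 2) % 2 = 1 ∧ n / 2 < 2 * 2)) := by omega
  have k1 : ((n / 2 + 1) % 2 = 0 ∧ (n / 2 + 1 < 2 ∨ 2 * 2 - 2 < n / 2 + 1)) ∨ ((n / 2 + 1) % 2 = 1 ∧ n / 2 + 1 < 2 * 2) := by omega
  have k2 : ¬ (((n / 2 + 2) % 2 = 0 ∧ (n / 2 + 2 < 2 ∨ 2 * 2 - 2 < n / 2 + 2)) ∨ ((n / 2 + 2) % 2 = 1 ∧ n / 2 + 2 < 2 * 2)) := by omega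
  have k3 : ((n / 2 + 3) % 2 = 0 ∧ (n / 2 + 3 < 2 ∨ 2 * 2 - 2 < n / 2 + 3)) ∨ ((n / 2 + 3) % 2 = 1 ∧ n / 2 + 3 < 2 * 2) := by omega
  have k4 : ¬ (((n / 2 + 4) % 2 = 0 ∧ (n / 2 + 4 < 2 ∨ 2 * 2 - 2 < n / 2 + 4)) ∨ ((n / 2 + 4) % 2 = 1 ∧ n / 2 + 4 < 2 * 2)) := by omega
  simp only [e0, e1, e2, e3, e4, g0, g1, g2, g3, g4, f0, k0, k1, k2, k3, k4, if_true, if_false]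
  decide

/-- the two reads of `orAnti` never both hit the block (`n ≥ 12`). -/
theorem card_block_and_reads_zero (hn : 12 ≤ n) (E : Fin n → Prop) [DecidablePred E] :
    (univ.filter fun b : Fin n => E b ∧ (pentIn n 2 (shift n 1 b) && pentIn n 2 (shift n (1 + n / 2) b)) = true).card = 0 := by
  refine Finset.card_eq_zero.mpr (Finset.filter_eq_empty_iff.mpr fun b _ h => ?_)
  have hb := b.isLt
  simp only [Bool.and_eq_true, pentIn_two_apply, decide_eq_true_eq, val_shift] at h
  rcases h with ⟨-, h1, h2⟩
  rcases Nat.lt_or_ge ((b : ℕ) + 1) n with c1 | c1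
  · rw [Nat.mod_eq_of_lt c1] at h1
    rcases Nat.lt_or_ge ((b : ℕ) + (1 + n / 2)) n with c2 | c2
    · rw [Nat.mod_eq_of_lt c2] at h2; omega
    · rw [show (b : ℕ) + (1 + n / 2) = ((b : ℕ) + 1 + n / 2 - n) + n by omega, Nat.add_mod_right, Nat.mod_eq_of_lt (by omega)] at h2
      omega
  · rw [show (b : ℕ) + 1 = 0 + n by omega, Nat.add_mod_right, Nat.zero_mod] at h1
    rw [show (b : ℕ) + (1 + n / 2) = (n / 2) + n by omega, Nat.add_mod_right, Nat.mod_eq_of_lt (by omega)] at h2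
    omega

/-- ★ THE BLOCK OF FIVE BEATS THE OR-ANTIPODE: at every `n ≡ 0 (mod 4)`, `n ≥ 12`, the §11 strategy `orAnti` (perfect to weight 3)
LOSES on `1_{[0,4]}` — its count over the pent electorate is `3 + 2 − 0`. -/
theorem orAnti_loses_block (h4 : n % 4 = 0) (hn : 12 ≤ n) : ¬ Rel (pentIn n 2) (ans (orAnti n) (pentIn n 2)) := by
  have he : n % 2 = 0 := by omega
  rw [rel_pent_iff he (M := 2) rfl le_rfl (by omega), ans_orAnti, card_or_mod_two, card_block_and_reads_zero hn,
    card_filter_and_shift _ _ (show 1 ≤ n by omega), card_filter_and_shift _ _ (show 1 + n / 2 ≤ n by omega),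
    card_filter_and_block _ (by omega), card_filter_and_block _ (by omega)]
  simp only [val_shift]
  have e0 : (0 + (n - 1)) % n = n - 1 := by rw [Nat.zero_add]; exact Nat.mod_eq_of_lt (by omega)
  have e1 : (1 + (n - 1)) % n = 0 := by rw [show 1 + (n - 1) = n by omega, Nat.mod_self]
  have e2 : (2 + (n - 1)) % n = 1 := by rw [show 2 + (n - 1) = 1 + n by omega, Nat.add_mod_right, Nat.mod_eq_of_lt (by omega)]
  have e3 : (3 + (n - 1)) % n = 2 := by rw [show 3 + (n - 1) = 2 + n by omega, Nat.add_mod_right, Nat.mod_eq_of_lt (by omega)]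
  have e4 : (4 + (n - 1)) % n = 3 := by rw [show 4 + (n - 1) = 3 + n by omega, Nat.add_mod_right, Nat.mod_eq_of_lt (by omega)]
  have g0 : (0 + (n - (1 + n / 2))) % n = n / 2 - 1 := by rw [show 0 + (n - (1 + n / 2)) = n / 2 - 1 by omega, Nat.mod_eq_of_lt (by omega)]
  have g1 : (1 + (n - (1 + n / 2))) % n = n / 2 := by rw [show 1 + (n - (1 + n / 2)) = n / 2 by omega, Nat.mod_eq_of_lt (by omega)]
  have g2 : (2 + (n - (1 + n / 2))) % n = n / 2 + 1 := by
    rw [show 2 + (n - (1 + n / 2)) = n / 2 + 1 by omega, Nat.mod_eq_of_lt (by omega)]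
  have g3 : (3 + (n - (1 + n / 2))) % n = n / 2 + 2 := by
    rw [show 3 + (n - (1 + n / 2)) = n / 2 + 2 by omega, Nat.mod_eq_of_lt (by omega)]
  have g4 : (4 + (n - (1 + n / 2))) % n = n / 2 + 3 := by
    rw [show 4 + (n - (1 + n / 2)) = n / 2 + 3 by omega, Nat.mod_eq_of_lt (by omega)]
  have f0 : ¬ (((n - 1) % 2 = 0 ∧ (n - 1 < 2 ∨ 2 * 2 - 2 < n - 1)) ∨ ((n - 1) % 2 = 1 ∧ n - 1 < 2 * 2)) := by omega
  have k0 : ¬ (((n / 2 - 1) % 2 = 0 ∧ (n / 2 - 1 < 2 ∨ 2 * 2 - 2 < n / 2 - 1)) ∨ ((n / 2 - 1) % 2 = 1 ∧ n / 2 - 1 < 2 * 2)) := by omega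
  have k1 : ((n / 2) % 2 = 0 ∧ (n / 2 < 2 ∨ 2 * 2 - 2 < n / 2)) ∨ ((n / 2) % 2 = 1 ∧ n / 2 < 2 * 2) := by omega
  have k2 : ¬ (((n / 2 + 1) % 2 = 0 ∧ (n / 2 + 1 < 2 ∨ 2 * 2 - 2 < n / 2 + 1)) ∨ ((n / 2 + 1) % 2 = 1 ∧ n / 2 + 1 < 2 * 2)) := by omega
  have k3 : ((n / 2 + 2) % 2 = 0 ∧ (n / 2 + 2 < 2 ∨ 2 * 2 - 2 < n / 2 + 2)) ∨ ((n / 2 + 2) % 2 = 1 ∧ n / 2 + 2 < 2 * 2) := by omega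
  have k4 : ¬ (((n / 2 + 3) % 2 = 0 ∧ (n / 2 + 3 < 2 ∨ 2 * 2 - 2 < n / 2 + 3)) ∨ ((n / 2 + 3) % 2 = 1 ∧ n / 2 + 3 < 2 * 2)) := by omega
  simp only [e0, e1, e2, e3, e4, g0, g1, g2, g3, g4, f0, k0, k1, k2, k3, k4, if_true, if_false]
  decide

/-! ### Axiom audit -/

/-- info: 'Summit.QuantumAdvantage.QuantumAdvantage.Theorems.CertDial.rel_pent_iff' depends on axioms: [propext,
 Classical.choice,
 Quot.sound] -/
#guard_msgs in #print axioms rel_pent_iff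

/-- info: 'Summit.QuantumAdvantage.QuantumAdvantage.Theorems.CertDial.xorAnti_loses_block' depends on axioms: [propext,
 Classical.choice,
 Quot.sound] -/
#guard_msgs in #print axioms xorAnti_loses_block

/-- info: 'Summit.QuantumAdvantage.QuantumAdvantage.Theorems.CertDial.orAnti_loses_block' depends on axioms: [propext,
 Classical.choice,
 Quot.sound] -/
#guard_msgs in #print axioms orAnti_loses_block

end Summit.QuantumAdvantage.QuantumAdvantage.Theorems.CertDial
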